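import Summits.Langlands.Langlands.Theorems.IrreducibilityBySelfDualityReciprocityUpToIrreducibilityRamifiedPlaces
import Summits.Langlands.Langlands.Theorems.IrreducibilityBySelfDualityReciprocityUpToIrreducibilityAboveUnramified
import HarnessLib

/-!
# Line `Sketch` for the crux `ReciprocityUpToIrreducibility` (item stmt-Langlands-14328), wave N9-D:
# rank one at a place `v ∣ ℓ` where the Hecke character may RAMIFY — the local–global clause IS the
# compatibility of `Rec`'s Artin map with class field theory on the pair, relative to the pinned datum

Support file (closes nothing; continuation lead c8, stub `stub_rankOne_localGlobal_above_iff_artinCompatible`).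

c7 (`…RamifiedPlaces`) proved, at a place `v ∤ ℓ`, for a `GL₁` datum `π` acted on by `GL₁(𝔸_K)` through
`θ ∘ det` modulo `W'` and `ρ : Γ_K → GL₁(ℚ̄_ℓ)` with finite inertia image on `W_{K_v}`
(`WeilGroup.IsContinuousRep`):

  `LocalGlobalCompatibleAt Rec ι π ρ v ↔ ∀ w ∈ W_{K_v}, ι(tr ρ|_{Γ_{K_v}}(w)) = θ_v((Rec.llc v).artin w)`,

the `v ∤ ℓ` conjunct of the clause being served by the Grothendieck–Deligne recipe.  This file is the SAME
statement at a place `v ∣ ℓ` (`rankOne_localGlobalCompatibleAt_above_iff_artinCompatible`), where the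
`v ∣ ℓ` conjunct `∀ hv, (Rec.pst ℓ v hv).IsWeilDeligneOf (ρ.toLocal v) r` — `Rec.pst ℓ v hv` is Fontaine's
pinned datum `fontainePstAdicCompletion v ℓ hv` by `rfl` — is served instead by two HYPOTHESES on the pair
`(ρ, v)`: the pinned datum attaches SOME Weil–Deligne representation to `ρ|_{Γ_{K_v}}` (`hex`), and every
attached one is `≅ (ρ|_{W_{K_v}}, N = 0)` (`huniq`).  This is the behaviour of `WD ∘ D_pst` on every
potentially unramified representation (potentially crystalline of weight `0`; Fontaine 1994, Exp. VIII
§1.3, §2.3.7 — the lead's recommended clause (F9)); for `ρ` unramified at `v` it is c3's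
`fontainePstAdicCompletion_isWeilDeligneOf_of_isUnramifiedAt` (clause (F8)), whence the unconditional
corollary `rankOne_localGlobalCompatibleAt_above_iff_artinCompatible_of_isUnramifiedAt` under
`FontaineDatumExists`.

* `⇐` (`rankOne_localGlobalCompatibleAt_above_of_artinCompatible`): local component `θ_v ∘ det`
  (`hasLocalComponentAt_ofQuasiChar`); the transport `rℂ` of `(ρ|_{W_{K_v}}, 0)` along `ι` has `N = 0` and
  acts by the scalars `ι(tr ρ(w)) = θ_v(artin_v w)` (`transport_ofRep_rankOne`), hence has class
  `rec_v[θ_v ∘ det]` (S-C `hasFrobSemisimpleClass_recGL_one_of_forall`); the clause's `r` is the attached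
  `r₀` of `hex`, whose transport `rℂ₀` is `≅ rℂ` (`isEquivalent_of_isTransportAlong` on `huniq r₀`) and so
  has the same class (`hasFrobSemisimpleClass_of_isEquivalent`).
* `⇒` (`artinCompatible_of_rankOne_localGlobalCompatibleAt_above`): the attached `r` of the clause is
  `≅ (ρ|_{W_{K_v}}, 0)` (`huniq`), so a transport `rℂ₁` of the latter inherits the class `rec_v(π_v)`;
  ANY local component acts through `θ_v ∘ det` (S-E `localComponent_ρ_apply_eq_of_hasLocalComponentAt`),
  so `rec_v(π_v) = rec_v[θ_v ∘ det]` (`IsLocalLanglandsGL.rec_one_mk`), the class pins the scalars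
  `θ_v(artin_v w)` (S-F `N_eq_zero_and_forall_of_hasFrobSemisimpleClass_recGL_one`), and they are
  `ι(tr ρ(w))` (`eq_of_transport_ofRep_rankOne_of_eq_smul`).

So in rank one, once (F9) lands, the sector "`θ` possibly ramified above `ℓ`" needs nothing beyond the
compatibility of `Rec`'s local Artin map with global class field theory on `(θ_v, ρ|_{W_{K_v}})`.
No definitions; std axioms; no named fact assumed by the stub (the corollary on the unramified sector
takes `FontaineDatumExists` as an explicit hypothesis, as c3 does).
-/

noncomputable section

set_option linter.dupNamespace false -- project-wide option (lakefile weak.linter.dupNamespace); `Summit.Langlands.Langlands` is the mandated namespace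

open scoped MatrixGroups Matrix NumberField Classical
open Filter IsDedekindDomain Field
open Literature.NumberTheory.Automorphic Literature.NumberTheory.GaloisRepresentations
open Literature.NumberTheory.PAdicHodge
open Summit.Langlands

namespace Summit.Langlands.Langlands.Theorems.ReciprocityUpToIrreducibility

/-! ## 1. Rank one at a place `v ∣ ℓ`: the clause ↔ Artin compatibility on the pair, relative to the
pinned datum attaching `(ρ|_{W_{K_v}}, 0)` -/

section Summit

variable {K : Type} [Field K] [NumberField K] {ℓ : ℕ} [Fact ℓ.Prime]
  {hcpt : isCompact_glFiniteIntegralLevel 1 K}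

/-- **Rank one, every `Rec`, a place `v ∣ ℓ` (ramified or not), `⇐`.**  Let `GL₁(𝔸_K)` act on
`π = W/W'` through `θ ∘ det` (mod `W'`), let `ρ : Γ_K → GL₁(ℚ̄_ℓ)` have finite inertia image on
`W_{K_v}`, and suppose the pinned datum `fontainePstAdicCompletion v ℓ hv` attaches some Weil–Deligne
representation to `ρ|_{Γ_{K_v}}`, every attached one being `≅ (ρ|_{W_{K_v}}, 0)` (Fontaine, Exp. VIII
§2.3.7 on the potentially unramified sector).  If `ι(tr ρ(w)) = θ_v(artin_v w)` for every `w ∈ W_{K_v}`,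
then `LocalGlobalCompatibleAt Rec ι π ρ v`: local component `θ_v ∘ det`, the transport of
`(ρ|_{W_{K_v}}, 0)` along `ι` acts by `θ_v(artin_v w)` with `N = 0` and so has class `rec_v[θ_v ∘ det]`
(S-C), and the transport of the attached `r₀` is isomorphic to it (transports of isomorphic
Weil–Deligne representations are isomorphic; the Frobenius-semisimple class is an isomorphism invariant).
[cite: HarrisTaylorAMS2001, Thm. A (i)] [cite: FontaineAsterisque223VIII, §2.3.7]
[cite: TateCorvallis1979, (4.2.1)] [cite: DeligneAntwerpII1973, §8.4.3 and §8.6] -/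
theorem rankOne_localGlobalCompatibleAt_above_of_artinCompatible
    (Rec : ReciprocityData K) (ι : PadicAlgCl ℓ ≃+* ℂ)
    (π : AutomorphicRepData (AutomorphyDatum.gl 1 K hcpt)) (θ : HeckeCharacter K)
    (hact : ∀ (g : (AdelicGroupData.gl 1 K).Adelic), ∀ φ ∈ π.W,
      rightTranslation (AdelicGroupData.gl 1 K) g φ -
        ((θ (Matrix.GeneralLinearGroup.det g) : ℂˣ) : ℂ) • φ ∈ π.W')
    (ρ : FramedGaloisRep K (PadicAlgCl ℓ) 1) {v : HeightOneSpectrum (𝓞 K)}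
    (hv : ((ℓ : ℕ) : 𝓞 K) ∈ v.asIdeal)
    (hc : WeilGroup.IsContinuousRep ((ρ.toLocal v).weilRestrict (v.adicCompletion K)))
    (hex : ∃ r, (fontainePstAdicCompletion v ℓ hv).IsWeilDeligneOf (ρ.toLocal v) r)
    (huniq : ∀ r, (fontainePstAdicCompletion v ℓ hv).IsWeilDeligneOf (ρ.toLocal v) r →
      r.IsEquivalent (WeilDeligneRep.ofRep ((ρ.toLocal v).weilRestrict (v.adicCompletion K)) hc))
    (hcomp : ∀ w : WeilGroup (v.adicCompletion K),
      (ι : PadicAlgCl ℓ →+* ℂ) ((((ρ.toLocal v).toWeilGroupHom w : GL (Fin 1) (PadicAlgCl ℓ)) :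
          Matrix (Fin 1) (Fin 1) (PadicAlgCl ℓ)).trace) =
        ((θ.localComponent v ((Rec.llc v).artin.artin w) : ℂˣ) : ℂ)) :
    LocalGlobalCompatibleAt Rec ι π ρ v := by
  obtain ⟨θv, hθv⟩ := exists_quasiChar_eq_localComponent θ v
  have hloc := hasLocalComponentAt_ofQuasiChar π θ hact v θv hθv
  -- the transport of `(ρ|_{W_{K_v}}, 0)` along `ι` acts by `θ_v(artin_v w)`, `N = 0`
  obtain ⟨rℂ, htr⟩ := exists_isTransportAlong (ι : PadicAlgCl ℓ →+* ℂ)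
    (WeilDeligneRep.ofRep ((ρ.toLocal v).weilRestrict (v.adicCompletion K)) hc)
  obtain ⟨hN, hρw⟩ := transport_ofRep_rankOne (ρ.toLocal v) hc (ι : PadicAlgCl ℓ →+* ℂ) htr
  have hρw' : ∀ w : WeilGroup (v.adicCompletion K),
      rℂ.ρ w = ((θv ((Rec.llc v).artin.artin w) : ℂˣ) : ℂ) • LinearMap.id := fun w => by
    rw [hρw w, hcomp w, hθv]
  have hcls := hasFrobSemisimpleClass_recGL_one_of_forall (Rec.llc v) rℂ hN hρw'
  -- the attached `r₀` of the pinned datum, transported along `ι`, is `≅ rℂ`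
  obtain ⟨r₀, hr₀⟩ := hex
  obtain ⟨rℂ₀, htr₀⟩ := exists_isTransportAlong (ι : PadicAlgCl ℓ →+* ℂ) r₀
  obtain ⟨e⟩ := isEquivalent_of_isTransportAlong _ (huniq r₀ hr₀) htr₀ htr
  exact ⟨SmoothIrrep.ofQuasiChar θv, r₀, rℂ₀, hloc, fun h => absurd hv h, fun _ => hr₀, htr₀,
    hasFrobSemisimpleClass_of_isEquivalent ⟨e.symm⟩ hcls⟩

/-- **Rank one, every `Rec`, a place `v ∣ ℓ`, `⇒`.**  Conversely, if every Weil–Deligne representation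
the pinned datum attaches to `ρ|_{Γ_{K_v}}` is `≅ (ρ|_{W_{K_v}}, 0)`, then
`LocalGlobalCompatibleAt Rec ι π ρ v` forces `ι(tr ρ(w)) = θ_v(artin_v w)` for every `w ∈ W_{K_v}`: the
attached `r` of the clause is `≅ (ρ|_{W_{K_v}}, 0)`, so a transport `rℂ₁` of the latter along `ι`
inherits the class `rec_v(π_v)`; any local component acts through `θ_v ∘ det` (S-E), so that class is
`rec_v[θ_v ∘ det]` (`IsLocalLanglandsGL.rec_one_mk`), and a Weil–Deligne representation on the line in
that class acts by `θ_v(artin_v w)` (S-F), while `rℂ₁` acts by `ι(tr ρ(w))`.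
[cite: HarrisTaylorAMS2001, Thm. A (i)] [cite: FontaineAsterisque223VIII, §2.3.7]
[cite: FlathCorvallis1979, Thm. 3] [cite: DeligneAntwerpII1973, §8.4.3 and §8.6] -/
theorem artinCompatible_of_rankOne_localGlobalCompatibleAt_above
    (Rec : ReciprocityData K) (ι : PadicAlgCl ℓ ≃+* ℂ)
    (π : AutomorphicRepData (AutomorphyDatum.gl 1 K hcpt)) (θ : HeckeCharacter K)
    (hact : ∀ (g : (AdelicGroupData.gl 1 K).Adelic), ∀ φ ∈ π.W,
      rightTranslation (AdelicGroupData.gl 1 K) g φ -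
        ((θ (Matrix.GeneralLinearGroup.det g) : ℂˣ) : ℂ) • φ ∈ π.W')
    (ρ : FramedGaloisRep K (PadicAlgCl ℓ) 1) {v : HeightOneSpectrum (𝓞 K)}
    (hv : ((ℓ : ℕ) : 𝓞 K) ∈ v.asIdeal)
    (hc : WeilGroup.IsContinuousRep ((ρ.toLocal v).weilRestrict (v.adicCompletion K)))
    (huniq : ∀ r, (fontainePstAdicCompletion v ℓ hv).IsWeilDeligneOf (ρ.toLocal v) r →
      r.IsEquivalent (WeilDeligneRep.ofRep ((ρ.toLocal v).weilRestrict (v.adicCompletion K)) hc))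
    (h : LocalGlobalCompatibleAt Rec ι π ρ v) :
    ∀ w : WeilGroup (v.adicCompletion K),
      (ι : PadicAlgCl ℓ →+* ℂ) ((((ρ.toLocal v).toWeilGroupHom w : GL (Fin 1) (PadicAlgCl ℓ)) :
          Matrix (Fin 1) (Fin 1) (PadicAlgCl ℓ)).trace) =
        ((θ.localComponent v ((Rec.llc v).artin.artin w) : ℂˣ) : ℂ) := by
  obtain ⟨πv, r, rℂ, hloc, -, hpst, htr, hcls⟩ := h
  -- the attached `r` is `≅ (ρ|_{W_{K_v}}, 0)`: a transport of the latter inherits the class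
  obtain ⟨rℂ₁, htr₁⟩ := exists_isTransportAlong (ι : PadicAlgCl ℓ →+* ℂ)
    (WeilDeligneRep.ofRep ((ρ.toLocal v).weilRestrict (v.adicCompletion K)) hc)
  have hcls₁ : rℂ₁.HasFrobSemisimpleClass ((Rec.llc v).recGL 1 (IrrClass.mk πv)) :=
    hasFrobSemisimpleClass_of_isEquivalent
      (isEquivalent_of_isTransportAlong _ (huniq r (hpst hv)) htr htr₁) hcls
  obtain ⟨θv, hθv⟩ := exists_quasiChar_eq_localComponent θ v
  -- any local component acts through `θ_v ∘ det`, so `rec_v(π_v) = rec_v(θ_v ∘ det)`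
  have hπv : ∀ (g : GL (Fin 1) (v.adicCompletion K)) (x : πv.V),
      πv.ρ g x = ((θv (Matrix.GeneralLinearGroup.det g) : ℂˣ) : ℂ) • x := fun g x => by
    rw [localComponent_ρ_apply_eq_of_hasLocalComponentAt π θ hact v πv hloc g x, hθv]
  have hcls' : rℂ₁.HasFrobSemisimpleClass
      ((Rec.llc v).recGL 1 (IrrClass.mk (SmoothIrrep.ofQuasiChar θv))) := by
    rw [(Rec.llc v).isLocalLanglands.rec_one_mk (SmoothIrrep.ofQuasiChar_ρ_apply θv),
      ← (Rec.llc v).isLocalLanglands.rec_one_mk hπv]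
    exact hcls₁
  obtain ⟨-, hρw⟩ := N_eq_zero_and_forall_of_hasFrobSemisimpleClass_recGL_one (Rec.llc v) hcls'
  intro w
  rw [eq_of_transport_ofRep_rankOne_of_eq_smul (ρ.toLocal v) hc (ι : PadicAlgCl ℓ →+* ℂ) htr₁ (hρw w),
    hθv]

/-- **Rank one, every `Rec`, a place `v ∣ ℓ`: relative to the pinned datum attaching `(ρ|_{W_{K_v}}, 0)`
to `ρ|_{Γ_{K_v}}`, the summit's local–global clause IS the compatibility of `Rec`'s Artin map at `v` with
class field theory on the pair** — the `v ∣ ℓ` twin of c7's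
`rankOne_localGlobalCompatibleAt_away_iff_artinCompatible`.  For `π` acted on through `θ ∘ det` and
`ρ : Γ_K → GL₁(ℚ̄_ℓ)` with finite inertia image on `W_{K_v}`, if the pinned datum attaches some `r` to
`ρ|_{Γ_{K_v}}` and every attached `r` is `≅ (ρ|_{W_{K_v}}, 0)`, then
`LocalGlobalCompatibleAt Rec ι π ρ v ↔ ∀ w ∈ W_{K_v}, ι(tr ρ|_{Γ_{K_v}}(w)) = θ_v((Rec.llc v).artin w)`.
[cite: HarrisTaylorAMS2001, Thm. A (i)] [cite: TateCorvallis1979, (4.2.1)]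
[cite: FontaineAsterisque223VIII, §2.3.7] -/
theorem rankOne_localGlobalCompatibleAt_above_iff_artinCompatible
    (Rec : ReciprocityData K) (ι : PadicAlgCl ℓ ≃+* ℂ)
    (π : AutomorphicRepData (AutomorphyDatum.gl 1 K hcpt)) (θ : HeckeCharacter K)
    (hact : ∀ (g : (AdelicGroupData.gl 1 K).Adelic), ∀ φ ∈ π.W,
      rightTranslation (AdelicGroupData.gl 1 K) g φ -
        ((θ (Matrix.GeneralLinearGroup.det g) : ℂˣ) : ℂ) • φ ∈ π.W')
    (ρ : FramedGaloisRep K (PadicAlgCl ℓ) 1) {v : HeightOneSpectrum (𝓞 K)}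
    (hv : ((ℓ : ℕ) : 𝓞 K) ∈ v.asIdeal)
    (hc : WeilGroup.IsContinuousRep ((ρ.toLocal v).weilRestrict (v.adicCompletion K)))
    (hex : ∃ r, (fontainePstAdicCompletion v ℓ hv).IsWeilDeligneOf (ρ.toLocal v) r)
    (huniq : ∀ r, (fontainePstAdicCompletion v ℓ hv).IsWeilDeligneOf (ρ.toLocal v) r →
      r.IsEquivalent (WeilDeligneRep.ofRep ((ρ.toLocal v).weilRestrict (v.adicCompletion K)) hc)) :
    LocalGlobalCompatibleAt Rec ι π ρ v ↔
      ∀ w : WeilGroup (v.adicCompletion K),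
        (ι : PadicAlgCl ℓ →+* ℂ) ((((ρ.toLocal v).toWeilGroupHom w : GL (Fin 1) (PadicAlgCl ℓ)) :
            Matrix (Fin 1) (Fin 1) (PadicAlgCl ℓ)).trace) =
          ((θ.localComponent v ((Rec.llc v).artin.artin w) : ℂˣ) : ℂ) :=
  ⟨artinCompatible_of_rankOne_localGlobalCompatibleAt_above Rec ι π θ hact ρ hv hc huniq,
    rankOne_localGlobalCompatibleAt_above_of_artinCompatible Rec ι π θ hact ρ hv hc hex huniq⟩

/-- **On the unramified-at-`v` sector the two hypotheses hold** (under `FontaineDatumExists`, clause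
(F8), c3's `fontainePstAdicCompletion_isWeilDeligneOf_of_isUnramifiedAt`): for `ρ : Γ_K → GL₁(ℚ̄_ℓ)`
unramified at `v ∣ ℓ` and `π` acted on through `θ ∘ det` (with `θ` possibly RAMIFIED at `v`),
`LocalGlobalCompatibleAt Rec ι π ρ v ↔ ∀ w, ι(tr ρ(w)) = θ_v(artin_v w)`.
[cite: FontaineAsterisque223VIII, §1.3 and §2.3.7] [cite: TateCorvallis1979, (4.2.1)] -/
theorem rankOne_localGlobalCompatibleAt_above_iff_artinCompatible_of_isUnramifiedAt
    (hF : FontaineDatumExists) (Rec : ReciprocityData K) (ι : PadicAlgCl ℓ ≃+* ℂ)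
    (π : AutomorphicRepData (AutomorphyDatum.gl 1 K hcpt)) (θ : HeckeCharacter K)
    (hact : ∀ (g : (AdelicGroupData.gl 1 K).Adelic), ∀ φ ∈ π.W,
      rightTranslation (AdelicGroupData.gl 1 K) g φ -
        ((θ (Matrix.GeneralLinearGroup.det g) : ℂˣ) : ℂ) • φ ∈ π.W')
    (ρ : FramedGaloisRep K (PadicAlgCl ℓ) 1) {v : HeightOneSpectrum (𝓞 K)}
    (hv : ((ℓ : ℕ) : 𝓞 K) ∈ v.asIdeal) (hρ : ρ.IsUnramifiedAt v) :
    LocalGlobalCompatibleAt Rec ι π ρ v ↔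
      ∀ w : WeilGroup (v.adicCompletion K),
        (ι : PadicAlgCl ℓ →+* ℂ) ((((ρ.toLocal v).toWeilGroupHom w : GL (Fin 1) (PadicAlgCl ℓ)) :
            Matrix (Fin 1) (Fin 1) (PadicAlgCl ℓ)).trace) =
          ((θ.localComponent v ((Rec.llc v).artin.artin w) : ℂˣ) : ℂ) :=
  rankOne_localGlobalCompatibleAt_above_iff_artinCompatible Rec ι π θ hact ρ hv _
    (fontainePstAdicCompletion_isWeilDeligneOf_of_isUnramifiedAt hF ρ hρ hv).1
    (fontainePstAdicCompletion_isWeilDeligneOf_of_isUnramifiedAt hF ρ hρ hv).2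

/-- **Registered stub `stub_rankOne_localGlobal_above_iff_artinCompatible` of line `Sketch` (crux
stmt-Langlands-14328, wave N9-D), closed form of
`rankOne_localGlobalCompatibleAt_above_iff_artinCompatible`**: for every `Rec`, every place `v ∣ ℓ`, a
`GL₁` datum acted on through `θ ∘ det` (the Hecke character possibly RAMIFIED at `v`) and
`ρ : Γ_K → GL₁(ℚ̄_ℓ)` with finite inertia image on `W_{K_v}`, relative to the pinned datum attaching
`(ρ|_{W_{K_v}}, 0)` to `ρ|_{Γ_{K_v}}` (some `r` attached, every attached `r ≅ (ρ|_{W_{K_v}}, 0)`), the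
summit's local–global clause at `v` holds iff `ι(tr ρ|_{Γ_{K_v}}(w)) = θ_v((Rec.llc v).artin w)` for all
`w ∈ W_{K_v}`. [cite: HarrisTaylorAMS2001, Thm. A (i)] [cite: TateCorvallis1979, (4.2.1)]
[cite: FontaineAsterisque223VIII, §2.3.7] -/
theorem stub_rankOne_localGlobal_above_iff_artinCompatible :
    ∀ (K : Type) [Field K] [NumberField K] (ℓ : ℕ) [Fact ℓ.Prime]
      (hcpt : isCompact_glFiniteIntegralLevel 1 K) (Rec : ReciprocityData K) (ι : PadicAlgCl ℓ ≃+* ℂ)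
      (π : AutomorphicRepData (AutomorphyDatum.gl 1 K hcpt)) (θ : HeckeCharacter K),
      (∀ (g : (AdelicGroupData.gl 1 K).Adelic), ∀ φ ∈ π.W,
        rightTranslation (AdelicGroupData.gl 1 K) g φ -
          ((θ (Matrix.GeneralLinearGroup.det g) : ℂˣ) : ℂ) • φ ∈ π.W') →
      ∀ (ρ : FramedGaloisRep K (PadicAlgCl ℓ) 1) (v : HeightOneSpectrum (𝓞 K))
        (hv : ((ℓ : ℕ) : 𝓞 K) ∈ v.asIdeal)
        (hc : WeilGroup.IsContinuousRep ((ρ.toLocal v).weilRestrict (v.adicCompletion K))),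
        (∃ r, (Literature.NumberTheory.PAdicHodge.fontainePstAdicCompletion v ℓ hv).IsWeilDeligneOf (ρ.toLocal v) r) →
        (∀ r, (Literature.NumberTheory.PAdicHodge.fontainePstAdicCompletion v ℓ hv).IsWeilDeligneOf (ρ.toLocal v) r →
          r.IsEquivalent (WeilDeligneRep.ofRep ((ρ.toLocal v).weilRestrict (v.adicCompletion K)) hc)) →
        (LocalGlobalCompatibleAt Rec ι π ρ v ↔
          ∀ w : WeilGroup (v.adicCompletion K),
            (ι : PadicAlgCl ℓ →+* ℂ) ((((ρ.toLocal v).toWeilGroupHom w : GL (Fin 1) (PadicAlgCl ℓ)) :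
                Matrix (Fin 1) (Fin 1) (PadicAlgCl ℓ)).trace) =
              ((θ.localComponent v ((Rec.llc v).artin.artin w) : ℂˣ) : ℂ)) :=
  fun _ _ _ _ _ _ Rec ι π θ hact ρ _ hv hc hex huniq =>
    rankOne_localGlobalCompatibleAt_above_iff_artinCompatible Rec ι π θ hact ρ hv hc hex huniq

end Summit

end Summit.Langlands.Langlands.Theorems.ReciprocityUpToIrreducibility

end
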